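import Literature.NumberTheory.Sieve.CFSemigroupConvergents
import HarnessLib

/-!
# Separation of continued-fraction cylinders (support for `CFSemigroupCounting`)

Continuation of `CFSemigroupConvergents.lean` [MageeOhWinter2019, §2.1 II]: the Möbius form of
the convergents `x_{m+n}(d) = M_n(x_m(σⁿ d))` (`cfConv_add`), the functional equation
`x_{m+1}(d) = 1/(d 0 + x_m(σ d))` (`cfConv_succ_eq`), the gap between cylinders with different
first digits (`le_abs_cfConv_sub_cfConv`: `≥ 1/((B+1)²(B+2))` for digits in `[1, B]`), and the
separation estimate `cfValue_separation`: two digit sequences with digits in `[1, B]` that agree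
before place `n` and differ at place `n` have values `≥ (1/((B+1)²(B+2))) / (4 (B+1)^{2n})`
apart — the estimate behind the Hölder coding in `CFSemigroupDimension.lean` (compare the
derivative bound (2.1) and the disjoint intervals `I_a = g_a I_A` of [MageeOhWinter2019, §2.1 II]).
Folklore, fully proved.

## References

* M. Magee, H. Oh, D. Winter, J. reine angew. Math. 753 (2019) 89–135, §2.1 II. [MageeOhWinter2019]
-/

noncomputable section

open Filter Set
open scoped Topology

namespace Literature.NumberTheory.Sieve

variable {d : ℕ → ℕ}

/-! ### Möbius form of the convergents and the separation estimate -/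

/-- `x_{m+n}(d) = M_n(x_m(σⁿ d))`: `p_{m+n}/q_{m+n} = (a u + b)/(c u + e)` with
`M_n = (a b; c e)` and `u = x_m(σⁿ d)`. [folklore] -/
theorem cfConv_add (hd : ∀ i, 1 ≤ d i) (n m : ℕ) :
    cfConv d (m + n) =
      ((cfWord d n 0 0 : ℝ) * cfConv (fun i => d (i + n)) m + cfNum d n) /
        ((cfWord d n 1 0 : ℝ) * cfConv (fun i => d (i + n)) m + cfDen d n) := by
  have hd' : ∀ i, 1 ≤ (fun i => d (i + n)) i := fun i => hd (i + n)
  have hq := (cfDen_cast_pos hd' m).ne'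
  have hnum : cfNum d (m + n) = cfWord d n 0 0 * cfNum (fun i => d (i + n)) m +
      cfNum d n * cfDen (fun i => d (i + n)) m := by
    simp [cfNum, cfDen, cfWord_add, Matrix.mul_apply, Fin.sum_univ_two]
  have hden : cfDen d (m + n) = cfWord d n 1 0 * cfNum (fun i => d (i + n)) m +
      cfDen d n * cfDen (fun i => d (i + n)) m := by
    simp [cfNum, cfDen, cfWord_add, Matrix.mul_apply, Fin.sum_univ_two]
  have e1 : (cfWord d n 0 0 : ℝ) * cfConv (fun i => d (i + n)) m + cfNum d n =
      ((cfWord d n 0 0 : ℝ) * cfNum (fun i => d (i + n)) m +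
        cfNum d n * cfDen (fun i => d (i + n)) m) / cfDen (fun i => d (i + n)) m := by
    rw [cfConv]; field_simp
  have e2 : (cfWord d n 1 0 : ℝ) * cfConv (fun i => d (i + n)) m + cfDen d n =
      ((cfWord d n 1 0 : ℝ) * cfNum (fun i => d (i + n)) m +
        cfDen d n * cfDen (fun i => d (i + n)) m) / cfDen (fun i => d (i + n)) m := by
    rw [cfConv]; field_simp
  rw [e1, e2, div_div_div_cancel_right₀ hq, cfConv, hnum, hden]
  push_cast
  rfl

/-- `x_{m+1}(d) = 1 / (d 0 + x_m(σ d))`. [folklore] -/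
theorem cfConv_succ_eq (hd : ∀ i, 1 ≤ d i) (m : ℕ) :
    cfConv d (m + 1) = 1 / ((d 0 : ℝ) + cfConv (fun i => d (i + 1)) m) := by
  rw [cfConv_add hd 1 m, cfWord_succ_00, cfWord_succ_10, cfNum_one, cfDen_one]
  simp [add_comm]

/-- Lower bound `x_{m+1}(d) ≥ 1/(d 0 + 1)`. [folklore] -/
theorem le_cfConv_succ (hd : ∀ i, 1 ≤ d i) (m : ℕ) :
    1 / ((d 0 : ℝ) + 1) ≤ cfConv d (m + 1) := by
  rw [cfConv_succ_eq hd]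
  have hu := (cfConv_mem_Icc (d := fun i => d (i + 1)) (fun i => hd (i + 1)) m)
  have h0 : (0 : ℝ) < d 0 := by exact_mod_cast hd 0
  exact one_div_le_one_div_of_le (add_pos_of_pos_of_nonneg h0 hu.1) (by linarith [hu.2])

/-- Upper bound `x_{m+2}(d) ≤ 1/(d 0 + 1/(d 1 + 1))`. [folklore] -/
theorem cfConv_add_two_le (hd : ∀ i, 1 ≤ d i) (m : ℕ) :
    cfConv d (m + 2) ≤ 1 / ((d 0 : ℝ) + 1 / ((d 1 : ℝ) + 1)) := by
  rw [cfConv_succ_eq hd (m + 1)]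
  have hv : 1 / ((d 1 : ℝ) + 1) ≤ cfConv (fun i => d (i + 1)) (m + 1) := by
    simpa using le_cfConv_succ (d := fun i => d (i + 1)) (fun i => hd (i + 1)) m
  exact one_div_le_one_div_of_le (by positivity) (by linarith)

/-- The gap between cylinders with different first digits: if `t 0 < t' 0` and all digits are
`≤ B`, then `x_m(t) - x_m(t') ≥ 1/((B+1)²(B+2))` for `m ≥ 2`. [folklore] -/
theorem cfConv_sub_cfConv_of_lt {t t' : ℕ → ℕ} (ht : ∀ i, 1 ≤ t i) (ht' : ∀ i, 1 ≤ t' i)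
    {B : ℕ} (hB : ∀ i, t i ≤ B) (hB' : ∀ i, t' i ≤ B) (h : t 0 < t' 0) (m : ℕ) :
    1 / (((B : ℝ) + 1) ^ 2 * ((B : ℝ) + 2)) ≤ cfConv t (m + 2) - cfConv t' (m + 2) := by
  have hu : 1 / ((t 0 : ℝ) + 1) ≤ cfConv t (m + 2) := le_cfConv_succ ht (m + 1)
  have hu' : cfConv t' (m + 2) ≤ 1 / ((t' 0 : ℝ) + 1 / ((t' 1 : ℝ) + 1)) :=
    cfConv_add_two_le ht' m
  have h1 : (t 0 : ℝ) + 1 ≤ t' 0 := by exact_mod_cast h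
  have hB1 : (t' 1 : ℝ) ≤ B := by exact_mod_cast hB' 1
  have hB0 : (t 0 : ℝ) ≤ B := by exact_mod_cast hB 0
  have hBpos : (0 : ℝ) < (B : ℝ) + 1 := by positivity
  -- `u' ≤ 1/(t 0 + 1 + 1/(B+1))`
  have hstep1 : 1 / ((B : ℝ) + 1) ≤ 1 / ((t' 1 : ℝ) + 1) :=
    one_div_le_one_div_of_le (by positivity) (by linarith)
  have hu'2 : cfConv t' (m + 2) ≤ 1 / ((t 0 : ℝ) + 1 + 1 / ((B : ℝ) + 1)) := by
    refine hu'.trans (one_div_le_one_div_of_le (by positivity) ?_)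
    linarith
  -- the difference of the two bounds
  have hkey : 1 / (((B : ℝ) + 1) ^ 2 * ((B : ℝ) + 2)) ≤
      1 / ((t 0 : ℝ) + 1) - 1 / ((t 0 : ℝ) + 1 + 1 / ((B : ℝ) + 1)) := by
    have hsub : 1 / ((t 0 : ℝ) + 1) - 1 / ((t 0 : ℝ) + 1 + 1 / ((B : ℝ) + 1)) =
        (1 / ((B : ℝ) + 1)) / (((t 0 : ℝ) + 1) * ((t 0 : ℝ) + 1 + 1 / ((B : ℝ) + 1))) := by
      field_simp
      ring
    rw [hsub, div_le_div_iff₀ (by positivity) (by positivity)]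
    have h2 : (t 0 : ℝ) + 1 + 1 / ((B : ℝ) + 1) ≤ (B : ℝ) + 2 := by
      have : 1 / ((B : ℝ) + 1) ≤ 1 := by
        rw [div_le_one hBpos]; linarith
      linarith
    have hA : ((t 0 : ℝ) + 1) * ((t 0 : ℝ) + 1 + 1 / ((B : ℝ) + 1)) ≤
        ((B : ℝ) + 1) * ((B : ℝ) + 2) :=
      mul_le_mul (by linarith) h2 (by positivity) (by positivity)
    calc (1 : ℝ) * (((t 0 : ℝ) + 1) * ((t 0 : ℝ) + 1 + 1 / ((B : ℝ) + 1)))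
        ≤ 1 * (((B : ℝ) + 1) * ((B : ℝ) + 2)) := by rw [one_mul, one_mul]; exact hA
      _ = 1 / ((B : ℝ) + 1) * (((B : ℝ) + 1) ^ 2 * ((B : ℝ) + 2)) := by
          field_simp
  linarith

/-- The gap estimate, symmetric form: different first digits (all digits in `[1, B]`) force
`|x_m(t) - x_m(t')| ≥ 1/((B+1)²(B+2))` for `m ≥ 2`. [folklore] -/
theorem le_abs_cfConv_sub_cfConv {t t' : ℕ → ℕ} (ht : ∀ i, 1 ≤ t i) (ht' : ∀ i, 1 ≤ t' i)
    {B : ℕ} (hB : ∀ i, t i ≤ B) (hB' : ∀ i, t' i ≤ B) (h : t 0 ≠ t' 0) (m : ℕ) :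
    1 / (((B : ℝ) + 1) ^ 2 * ((B : ℝ) + 2)) ≤ |cfConv t (m + 2) - cfConv t' (m + 2)| := by
  rcases lt_or_gt_of_ne h with hlt | hlt
  · exact (cfConv_sub_cfConv_of_lt ht ht' hB hB' hlt m).trans (le_abs_self _)
  · rw [abs_sub_comm]
    exact (cfConv_sub_cfConv_of_lt ht' ht hB' hB hlt m).trans (le_abs_self _)

/-- Two digit sequences agreeing before place `n`: at depth `m + n` the convergents differ by
`|x_m(σⁿd) - x_m(σⁿd')| / ((c u + e)(c u' + e)) ≥ |x_m(σⁿd) - x_m(σⁿd')| / (4 q_n²)`. [folklore] -/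
theorem abs_cfConv_add_sub_ge (hd : ∀ i, 1 ≤ d i) {d' : ℕ → ℕ} (hd' : ∀ i, 1 ≤ d' i) {n : ℕ}
    (hagree : ∀ i < n, d i = d' i) (m : ℕ) :
    |cfConv (fun i => d (i + n)) m - cfConv (fun i => d' (i + n)) m| / (4 * (cfDen d n : ℝ) ^ 2) ≤
      |cfConv d (m + n) - cfConv d' (m + n)| := by
  have hu := cfConv_mem_Icc (d := fun i => d (i + n)) (fun i => hd (i + n)) m
  have hu' := cfConv_mem_Icc (d := fun i => d' (i + n)) (fun i => hd' (i + n)) m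
  have hW : cfWord d' n = cfWord d n := (cfWord_congr hagree).symm
  have he : (0 : ℝ) < (cfDen d n : ℝ) := cfDen_cast_pos hd n
  have hc0 : (0 : ℝ) ≤ (cfWord d n 1 0 : ℝ) := by exact_mod_cast cfWord_nonneg d n 1 0
  have hce : (cfWord d n 1 0 : ℝ) ≤ (cfDen d n : ℝ) := by exact_mod_cast cfWord_10_le_cfDen hd n
  have hdet : (cfWord d n 0 0 : ℝ) * cfDen d n - cfNum d n * cfWord d n 1 0 = (-1) ^ n := by
    have h := det_cfWord d n
    rw [Matrix.det_fin_two] at h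
    simp only [cfNum, cfDen]
    exact_mod_cast h
  have h1 := cfConv_add hd n m
  have h2 : cfConv d' (m + n) =
      ((cfWord d n 0 0 : ℝ) * cfConv (fun i => d' (i + n)) m + cfNum d n) /
        ((cfWord d n 1 0 : ℝ) * cfConv (fun i => d' (i + n)) m + cfDen d n) := by
    have h := cfConv_add hd' n m
    simp only [cfNum, cfDen, hW] at h ⊢
    exact h
  generalize cfConv (fun i => d (i + n)) m = u at hu h1 ⊢
  generalize cfConv (fun i => d' (i + n)) m = u' at hu' h2 ⊢
  generalize (cfWord d n 0 0 : ℝ) = a at hdet h1 h2 ⊢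
  generalize (cfNum d n : ℝ) = b at hdet h1 h2 ⊢
  generalize (cfWord d n 1 0 : ℝ) = c at hc0 hce hdet h1 h2 ⊢
  generalize (cfDen d n : ℝ) = e at he hce hdet h1 h2 ⊢
  have hD : 0 < c * u + e := by nlinarith [hu.1]
  have hD' : 0 < c * u' + e := by nlinarith [hu'.1]
  have hdiff : cfConv d (m + n) - cfConv d' (m + n) =
      (-1) ^ n * (u - u') / ((c * u + e) * (c * u' + e)) := by
    rw [h1, h2, div_sub_div _ _ hD.ne' hD'.ne', ← hdet]
    congr 1; ring
  rw [hdiff, abs_div, abs_mul, abs_pow, abs_neg, abs_one, one_pow, one_mul,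
    abs_of_pos (mul_pos hD hD')]
  have hden : (c * u + e) * (c * u' + e) ≤ 4 * e ^ 2 := by
    have h3 : c * u + e ≤ 2 * e := by nlinarith [hu.2]
    have h4 : c * u' + e ≤ 2 * e := by nlinarith [hu'.2]
    have := mul_le_mul h3 h4 hD'.le (by linarith)
    linarith
  exact div_le_div_of_nonneg_left (abs_nonneg _) (mul_pos hD hD') hden

/-- **Separation of cylinders.** If two digit sequences with digits in `[1, B]` agree before
place `n` and differ at place `n`, then
`|[0; d] - [0; d']| ≥ (1/((B+1)²(B+2))) / (4 (B+1)^{2n})`. [folklore] -/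
theorem cfValue_separation (hd : ∀ i, 1 ≤ d i) {d' : ℕ → ℕ} (hd' : ∀ i, 1 ≤ d' i) {B : ℕ}
    (hB : ∀ i, d i ≤ B) (hB' : ∀ i, d' i ≤ B) {n : ℕ} (hagree : ∀ i < n, d i = d' i)
    (hne : d n ≠ d' n) :
    1 / (((B : ℝ) + 1) ^ 2 * ((B : ℝ) + 2)) / (4 * (((B : ℝ) + 1) ^ 2) ^ n) ≤
      |cfValue d - cfValue d'| := by
  have hlim : Tendsto (fun m => |cfConv d (m + n) - cfConv d' (m + n)|) atTop
      (𝓝 |cfValue d - cfValue d'|) := by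
    have h1 := (tendsto_add_atTop_iff_nat n).2 (tendsto_cfConv_cfValue hd)
    have h2 := (tendsto_add_atTop_iff_nat n).2 (tendsto_cfConv_cfValue hd')
    exact (h1.sub h2).abs
  refine ge_of_tendsto hlim (eventually_atTop.2 ⟨2, fun m hm => ?_⟩)
  obtain ⟨m, rfl⟩ := Nat.exists_eq_add_of_le' hm
  have hgap := le_abs_cfConv_sub_cfConv (t := fun i => d (i + n)) (t' := fun i => d' (i + n))
    (fun i => hd (i + n)) (fun i => hd' (i + n)) (fun i => hB (i + n)) (fun i => hB' (i + n))
    (by simpa using hne) m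
  have hstep := abs_cfConv_add_sub_ge hd hd' hagree (m + 2)
  have he : (0 : ℝ) < (cfDen d n : ℝ) := cfDen_cast_pos hd n
  have hepow : (cfDen d n : ℝ) ≤ ((B : ℝ) + 1) ^ n := by exact_mod_cast cfDen_le_pow hd hB n
  have hsq : (cfDen d n : ℝ) ^ 2 ≤ (((B : ℝ) + 1) ^ 2) ^ n := by
    rw [← pow_mul, mul_comm 2 n, pow_mul]
    exact pow_le_pow_left₀ he.le hepow 2
  calc 1 / (((B : ℝ) + 1) ^ 2 * ((B : ℝ) + 2)) / (4 * (((B : ℝ) + 1) ^ 2) ^ n)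
      ≤ 1 / (((B : ℝ) + 1) ^ 2 * ((B : ℝ) + 2)) / (4 * (cfDen d n : ℝ) ^ 2) :=
        div_le_div_of_nonneg_left (by positivity) (by positivity) (by linarith)
    _ ≤ |cfConv (fun i => d (i + n)) (m + 2) - cfConv (fun i => d' (i + n)) (m + 2)| /
          (4 * (cfDen d n : ℝ) ^ 2) :=
        div_le_div_of_nonneg_right hgap (by positivity)
    _ ≤ |cfConv d (m + 2 + n) - cfConv d' (m + 2 + n)| := hstep

end Literature.NumberTheory.Sieve
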